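import Literature.MathematicalPhysics.QuantumLattice.LiebRobinsonHastingsKomaProofs
import HarnessLib

/-!
# Exponential clustering of a gapped ground state from commutator bounds (generic matrix form)

Hastings–Koma, CMP **265** (2006) 781, Thm. 8 / Nachtergaele–Sims, CMP **265** (2006) 119, Thm. 2,
in the form "gap + Lieb–Robinson-type commutator bounds ⟹ exponential clustering", for an
arbitrary Hermitian matrix `H` with a unique gapped ground state and two commuting observables
`A`, `B`. This is the tree's `clustering_core` (`LiebRobinsonHastingsKomaProofs.lean`, stated there
for the box Hamiltonians of a lattice spin interaction) with its two model-specific inputs — the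
Lipschitz constant `‖[H, B]‖ ≤ 2‖B‖ c_Y N` and the Lieb–Robinson bound
`‖[τ_t(B), A]‖ ≤ C‖B‖‖A‖ m e^{-μ(D - v|t|)}` — turned into hypotheses (`clustering_of_commutator_bounds`);
the proof is the same assembly of `abstract_clustering_bound`, `commutator_expect_eq_sum`,
`exists_ground_index` and `clustering_arith`. It is used for lattice FERMIONS (even observables,
the fermionic Lieb–Robinson bound `fermion_lieb_robinson_hamiltonianWith`) and for clustering "in
the `x₁`-direction" on a torus (Bachmann–Bols–De Roeck–Fraas, CMP **375** (2019), Assumption (v) and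
Prop. 2.4, which cites Hastings 2004 / Nachtergaele–Sims 2007 for exactly this input). Also the
trivial short-distance bound `norm_opExpect_mul_sub_le`. Theorems only.

## References

* M. B. Hastings, T. Koma, CMP **265** (2006) 781–804, Thm. 8 and §3. [HastingsKomaCMP2006]
* B. Nachtergaele, R. Sims, CMP **265** (2006) 119–130, Thm. 2. [NachtergaeleSimsCMP2006]
* S. Bachmann, A. Bols, W. De Roeck, M. Fraas, CMP **375** (2019) 1249, Assumption (v), Prop. 2.4.
  [BachmannEtAl2019]
-/

noncomputable section

open Matrix Complex Finset Real
open scoped Matrix.Norms.L2Operator ComplexOrder InnerProductSpace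

namespace Literature.MathematicalPhysics.QuantumLattice

variable {m : Type*} [Fintype m] [DecidableEq m]

/-- **Exponential clustering of a unique gapped ground state from a Lieb–Robinson-type bound
(generic matrix form of Hastings–Koma, CMP 265 (2006) Thm. 8 / Nachtergaele–Sims CMP 265 (2006)
Thm. 2).** Let `H` be a Hermitian matrix with a unique ground state `ψ` (normalised) and spectral
gap `γ > 0`, and let `A`, `B` commute. Suppose the Lipschitz input `‖[H, B]‖ ≤ 2‖B‖ c_Y N`, and the
Lieb–Robinson input `‖[τ_t(B), A]‖ ≤ C ‖B‖ ‖A‖ m e^{-μ(D - v|t|)}` for all `t` with `0 ≤ m ≤ c_Y`,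
`c_Y ≥ 1`, at "distance" `D ≥ max(2v, 1)`. Then
`|⟨AB⟩ - ⟨A⟩⟨B⟩| ≤ (2 + 4N + 4C/(vμ) + 8v/γ) ‖A‖ ‖B‖ c_Y e^{-D/ξ}`, `ξ = max(8/μ, 4v/γ)`.
This is the tree's `clustering_core` (which is this statement for box Hamiltonians of a lattice
interaction) with the lattice-specific inputs turned into hypotheses, so that it applies verbatim
to lattice fermions (even observables) and to any geometry (e.g. distances in one coordinate
direction on a torus, as in Bachmann–Bols–De Roeck–Fraas 2019, Assumption (v)). Proof: the
spectral data of `commutator_expect_eq_sum` fed into `abstract_clustering_bound` with parameters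
`T = D/2v`, `t₁ = e^{-μD/4}`, `α = γv/D`, and `clustering_arith`.
[cite: HastingsKomaCMP2006, Theorem 8 (proof, §3)] -/
theorem clustering_of_commutator_bounds {H A B : Matrix m m ℂ} (hH : H.IsHermitian)
    {γ C μ v D N cY mXY : ℝ} (hγ : 0 < γ) (hC : 0 ≤ C) (hμ : 0 < μ) (hv : 0 < v) (hN : 0 ≤ N)
    (hcY : 1 ≤ cY) (hm0 : 0 ≤ mXY) (hm : mXY ≤ cY)
    (hgap : H.HasSpectralGap γ) {ψ : m → ℂ} (hψ : H.IsGroundStateVector ψ)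
    (hψ1 : star ψ ⬝ᵥ ψ = 1) (hAB : Commute A B)
    (hcomm : ‖H * B - B * H‖ ≤ 2 * ‖B‖ * (cY * N))
    (hLR : ∀ t : ℝ, ‖heisenbergEvolution H t B * A - A * heisenbergEvolution H t B‖ ≤
      C * ‖B‖ * ‖A‖ * mXY * Real.exp (-μ * (D - v * |t|)))
    (hD : max (2 * v) 1 ≤ D) :
    ‖opExpect (A * B) ψ - opExpect A ψ * opExpect B ψ‖ ≤
      (2 + 4 * N + 4 * C / (v * μ) + 8 * v / γ) * ‖A‖ * ‖B‖ * cY *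
        Real.exp (-D / max (8 / μ) (4 * v / γ)) := by
  have hD1 : 1 ≤ D := le_trans (le_max_right _ _) hD
  have hD2v : 2 * v ≤ D := le_trans (le_max_left _ _) hD
  have hD0 : 0 < D := lt_of_lt_of_le one_pos hD1
  -- the ground state along the eigenbasis
  obtain ⟨i₀, c, hev0, hothers, hψc, hc⟩ := exists_ground_index hH hgap hψ hψ1
  have hψeig : H *ᵥ ψ = ((H.groundEnergy : ℝ) : ℂ) • ψ := hψ.2
  -- the data of the abstract bound (opaque functions with defining equations)
  obtain ⟨a, ha⟩ : ∃ a : m → ℂ, ∀ i, a i =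
      (star ψ ⬝ᵥ (A *ᵥ ⇑(hH.eigenvectorBasis i))) *
        (star (⇑(hH.eigenvectorBasis i)) ⬝ᵥ (B *ᵥ ψ)) := ⟨_, fun i => rfl⟩
  obtain ⟨b, hb⟩ : ∃ b : m → ℂ, ∀ i, b i =
      (star ψ ⬝ᵥ (B *ᵥ ⇑(hH.eigenvectorBasis i))) *
        (star (⇑(hH.eigenvectorBasis i)) ⬝ᵥ (A *ᵥ ψ)) := ⟨_, fun i => rfl⟩
  obtain ⟨Δ, hΔ⟩ : ∃ Δ : m → ℝ, ∀ i, Δ i = hH.eigenvalues i - H.groundEnergy := ⟨_, fun i => rfl⟩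
  obtain ⟨hfun, hhfun⟩ : ∃ hfun : ℝ → ℂ, ∀ t, hfun t =
      star ψ ⬝ᵥ ((A * heisenbergEvolution H t B - heisenbergEvolution H t B * A) *ᵥ ψ) :=
    ⟨_, fun t => rfl⟩
  -- hypotheses of the abstract bound
  have hΔ₀ : Δ i₀ = 0 := by rw [hΔ, hev0, sub_self]
  have hΔγ : ∀ i, i ≠ i₀ → γ ≤ Δ i := fun i hi => by
    rw [hΔ, le_sub_iff_add_le, add_comm]; exact hothers i hi
  have hab : a i₀ = b i₀ := by
    rw [ha, hb, ground_term_eq A B hψc hc, ground_term_eq B A hψc hc, mul_comm]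
  have hKa : ∑ i, ‖a i‖ ≤ ‖A‖ * ‖B‖ := by
    simp only [ha]; exact sum_norm_weights_le hH A B hψ1
  have hKb : ∑ i, ‖b i‖ ≤ ‖A‖ * ‖B‖ := by
    simp only [hb]; rw [mul_comm]; exact sum_norm_weights_le hH B A hψ1
  have hh : ∀ t : ℝ, hfun t =
      ∑ i, (a i * cexp ((t * Δ i : ℝ) * I) - b i * cexp (-(t * Δ i : ℝ) * I)) := fun t => by
    simp only [hhfun, ha, hb, hΔ]
    exact commutator_expect_eq_sum hH A B hψeig t
  have hL1 : ∀ t : ℝ, 0 < t → ‖hfun t - hfun (-t)‖ ≤ 4 * ‖A‖ * (2 * ‖B‖ * (cY * N)) * t := by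
    intro t ht
    rw [hhfun, hhfun]
    exact norm_commutator_expect_sub_le hH A B hψ1 hcomm ht
  have hL2 : ∀ t : ℝ, ‖hfun t‖ ≤
      C * ‖B‖ * ‖A‖ * mXY * Real.exp (-μ * D) * Real.exp (μ * v * |t|) := by
    intro t
    rw [hhfun]
    refine norm_commutator_expect_le_of_le hψ1 ((hLR t).trans (le_of_eq ?_))
    rw [show -μ * (D - v * |t|) = -μ * D + μ * v * |t| by ring, Real.exp_add, ← mul_assoc]
  have hL3 : ∀ t : ℝ, ‖hfun t‖ ≤ 2 * ‖A‖ * ‖B‖ := by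
    intro t
    rw [hhfun]
    exact norm_commutator_expect_le hH A B hψ1 t
  -- parameters
  have hα : 0 < γ * v / D := div_pos (mul_pos hγ hv) hD0
  have ht₁ : 0 < Real.exp (-(μ * D / 4)) := Real.exp_pos _
  have hT : Real.exp (-(μ * D / 4)) ≤ D / (2 * v) := exp_le_div_of_le hμ hv hD0 hD2v
  have key := abstract_clustering_bound i₀ Δ a b hfun hγ hα ht₁ hT (mul_pos hμ hv).le hΔ₀ hΔγ
    hab hKa hKb hh hL1 hL2 hL3
  -- identify the left-hand side with the connected correlation, and `h(0) = 0`
  have h0 : hfun 0 = 0 := by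
    rw [hhfun]
    exact commutator_expect_zero_of_commute ψ hAB
  have hsumall : ∑ i, a i = opExpect (A * B) ψ := by
    simp only [ha]
    rw [sum_dotProduct_mulVec_mul_dotProduct hH A ψ (B *ᵥ ψ), opExpect, ← mulVec_mulVec]
  have hai₀ : a i₀ = opExpect A ψ * opExpect B ψ := by
    rw [ha, ground_term_eq A B hψc hc]
    rfl
  rw [Finset.sum_erase_eq_sub (Finset.mem_univ i₀), hsumall, hai₀, h0, norm_zero] at key
  exact clustering_arith hC hμ hv hγ hN hD1 hD2v (norm_nonneg A) (norm_nonneg B) hcY hm0 hm key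

/-- **Short distances**: the trivial bound `|⟨AB⟩ - ⟨A⟩⟨B⟩| ≤ 2‖A‖‖B‖` for a unit vector.
[folklore] -/
theorem norm_opExpect_mul_sub_le (A B : Matrix m m ℂ) {ψ : m → ℂ} (hψ1 : star ψ ⬝ᵥ ψ = 1) :
    ‖opExpect (A * B) ψ - opExpect A ψ * opExpect B ψ‖ ≤ 2 * ‖A‖ * ‖B‖ := by
  have h1 : ‖opExpect (A * B) ψ‖ ≤ ‖A‖ * ‖B‖ :=
    (norm_vectorState_le hψ1 (A * B)).trans (Matrix.l2_opNorm_mul A B)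
  have h2 : ‖opExpect A ψ * opExpect B ψ‖ ≤ ‖A‖ * ‖B‖ := by
    rw [norm_mul]
    exact mul_le_mul (norm_vectorState_le hψ1 A) (norm_vectorState_le hψ1 B) (norm_nonneg _)
      (norm_nonneg _)
  calc ‖opExpect (A * B) ψ - opExpect A ψ * opExpect B ψ‖
      ≤ ‖opExpect (A * B) ψ‖ + ‖opExpect A ψ * opExpect B ψ‖ := norm_sub_le _ _
    _ ≤ ‖A‖ * ‖B‖ + ‖A‖ * ‖B‖ := add_le_add h1 h2
    _ = 2 * ‖A‖ * ‖B‖ := by ring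

end Literature.MathematicalPhysics.QuantumLattice

end
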